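import Summits.AtomisticToContinuum.HydrodynamicLimit.Theses.CollisionIsometryCLT

/-!
# Small models for the crux `CollisionIsometryCLT.AdaptedWeightCLT` — what diffuseness does NOT give

Negative knowledge for the crux `AdaptedWeightCLT` (stmt-AtomisticToContinuum-12949, route
`CollisionIsometryCLT`), from the standing disprover's `Cruxes/AdaptedWeightCLT/Disproof.lean` §2–§4
(cycle 1; refuter-cdisprove-stmt-AtomisticToContinuum-12949-0).  The crux feeds a conditional CLT with
two dynamical inputs only: H1 = "mean inverse participation ratio `ipr = (N+1)⁻¹∑ᵢ∑ₖ‖M_ik‖_F⁴ → 0`" of the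
exact collision-isometry transfer `M` (Lindeberg-normalised: `∑ₖ M_ik M_ikᵀ = I₃`) and H2 = velocity tails.
The checked facts below say which further inputs any proof must extract from the dynamics:

* `ipr_identity`, `row_ipr_floor` — the functional equals its ceiling `9` on a collision-free window and a
  row spread over `n` ancestors has ipr `≥ 9/n` (Cauchy–Schwarz): H1 is exactly "the number of ancestors
  carrying each row's weight diverges", no more;
* `diffuse_rows_need_not_isotropise` — Lindeberg-normalised rows with the MINIMAL ipr `9/n` that transport
  every (anisotropic) covariance unchanged: H1 encodes no rotational mixing (input I1 of the Disproof file);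
* `adapted_unit_rows_need_not_centre` — a unit row of minimal participation `1/n` chosen ADAPTED to the
  summands (by their signs) outputs `‖w‖₁/√n ≥ 0`: with adapted weights there is no CLT at all without a
  decorrelation/chaos input (input I2);
* `reflectVel_of_inner_eq_zero` — collision normals orthogonal to a fixed direction freeze that velocity
  component (the reflection-generated way to keep an anisotropy; it violates H1, consistently);
* `one_reflection_covariance` — one reflection turns independent isotropic covariances `θᵢ I`, `θⱼ I` into
  `θᵢ I + (θⱼ - θᵢ) ωωᵀ`: isotropy is transported, not produced, by a single adapted step;
* `partner_weight_after_reflection`, `self_weight_after_reflection` — the exact `3 = 2 + 1` split of a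
  fresh row's Frobenius budget under ONE `reflectVel` (ipr `9 → 5`) for every non-zero normal.
-/

noncomputable section

namespace Summit.AtomisticToContinuum.HydrodynamicLimit.Theorems

namespace AdaptedWeightCLTNegative

open scoped BigOperators InnerProductSpace Matrix
open Finset Literature.Analysis.FluidPDE Literature.MathematicalPhysics.KineticTheory

/-! ## The ipr functional: ceiling `9` (identity transfer) and floor `9/n` -/

/-- Row weights of the identity transfer: `∑ₐ ‖(e_k ⊗ e_a)_i‖² = 3·[i = k]`. [folklore] -/
theorem identity_row_weight (N : ℕ) (i k : Fin (N + 1)) :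
    (∑ a : Fin 3, ‖(Pi.single k (EuclideanSpace.single a (1 : ℝ)) : Fin (N + 1) → V3) i‖ ^ 2)
      = if i = k then 3 else 0 := by
  by_cases h : i = k
  · subst h
    simp
  · simp [h]

/-- The crux's `ipr` functional evaluated on the identity transfer (a collision-free window) is exactly
`9`, the ceiling of `ipr ∈ [9/(N+1), 9]`: H1 (`E ipr → 0`) is only ever true through collisions of all but
`o(N)` particles in every admissible window. [folklore] -/
theorem ipr_identity (N : ℕ) :
    ((N + 1 : ℕ) : ℝ)⁻¹ * ∑ i : Fin (N + 1), ∑ k : Fin (N + 1),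
      (∑ a : Fin 3, ‖(Pi.single k (EuclideanSpace.single a (1 : ℝ)) : Fin (N + 1) → V3) i‖ ^ 2) ^ 2
      = 9 := by
  simp_rw [identity_row_weight]
  have h : ∀ i : Fin (N + 1), ∑ k : Fin (N + 1), ((if i = k then (3 : ℝ) else 0) ^ 2) = 9 := by
    intro i
    rw [Finset.sum_eq_single i]
    · norm_num
    · intro b _ hb
      simp [Ne.symm hb]
    · simp
  simp_rw [h]
  simp [Finset.sum_const, Finset.card_univ]
  field_simp

/-- The floor: a row whose Frobenius budget `∑ₖ xₖ = 3` is spread over `n` ancestors has `∑ₖ xₖ² ≥ 9/n`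
(Cauchy–Schwarz), with equality iff all `xₖ = 3/n`. [folklore] -/
theorem row_ipr_floor {n : ℕ} (hn : 0 < n) (x : Fin n → ℝ) (hx : ∑ k, x k = 3) :
    9 / n ≤ ∑ k, x k ^ 2 := by
  have hn' : (0 : ℝ) < n := by exact_mod_cast hn
  have hcs := Finset.sum_mul_sq_le_sq_mul_sq (Finset.univ : Finset (Fin n)) x (fun _ => (1 : ℝ))
  simp only [mul_one, one_pow, Finset.sum_const, Finset.card_univ, Fintype.card_fin, nsmul_eq_mul,
    hx] at hcs
  rw [div_le_iff₀ hn']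
  linarith

/-! ## Diffuse + Lindeberg-normalised does not isotropise -/

/-- Every covariance passes unchanged through the row of `n` equal isotropic blocks `n^{-1/2} I₃`.
[folklore] -/
theorem isoBlock_cov {n : ℕ} (hn : 0 < n) (S : Matrix (Fin 3) (Fin 3) ℝ) :
    ∑ _k : Fin n, ((Real.sqrt n)⁻¹ • (1 : Matrix (Fin 3) (Fin 3) ℝ)) * S *
        ((Real.sqrt n)⁻¹ • (1 : Matrix (Fin 3) (Fin 3) ℝ))ᵀ = S := by
  have hn' : (0 : ℝ) < n := by exact_mod_cast hn
  have hc : ((Real.sqrt n)⁻¹ * (Real.sqrt n)⁻¹ : ℝ) = (n : ℝ)⁻¹ := by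
    rw [← mul_inv, Real.mul_self_sqrt hn'.le]
  simp only [Matrix.transpose_smul, Matrix.transpose_one, Matrix.smul_mul, Matrix.mul_smul,
    Matrix.mul_one, Matrix.one_mul, smul_smul, hc, Finset.sum_const, Finset.card_univ, Fintype.card_fin]
  rw [← Nat.cast_smul_eq_nsmul ℝ, smul_smul, mul_inv_cancel₀ hn'.ne', one_smul]

/-- Frobenius weight of one isotropic block: `‖n^{-1/2} I₃‖_F² = 3/n`. [folklore] -/
theorem isoBlock_frob {n : ℕ} (hn : 0 < n) :
    ∑ a : Fin 3, ∑ b : Fin 3, (((Real.sqrt n)⁻¹ • (1 : Matrix (Fin 3) (Fin 3) ℝ)) a b) ^ 2 = 3 / n := by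
  have hn' : (0 : ℝ) < n := by exact_mod_cast hn
  simp [Matrix.one_apply, Finset.sum_ite_eq, inv_pow, Real.sq_sqrt hn'.le]
  ring

/-- **Diffuse rows need not isotropise.** For every `n ≥ 1` there is a Lindeberg-normalised row of `n`
blocks (`∑ₖ Bₖ Bₖᵀ = I₃`) with the minimal possible ipr `∑ₖ ‖Bₖ‖_F⁴ = 9/n` that fixes EVERY covariance `S`,
in particular every traceless one: "mean ipr → 0" plus the exact `ℓ²` budget cannot by themselves make the
block kinetic stress isotropic. [folklore] -/
theorem diffuse_rows_need_not_isotropise (n : ℕ) (hn : 0 < n) :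
    ∃ B : Fin n → Matrix (Fin 3) (Fin 3) ℝ,
      (∑ k, B k * (B k)ᵀ = 1) ∧ (∑ k, (∑ a : Fin 3, ∑ b : Fin 3, (B k a b) ^ 2) ^ 2 = 9 / n) ∧
      ∀ S : Matrix (Fin 3) (Fin 3) ℝ, ∑ k, B k * S * (B k)ᵀ = S := by
  have hn' : (0 : ℝ) < n := by exact_mod_cast hn
  refine ⟨fun _ => (Real.sqrt n)⁻¹ • (1 : Matrix (Fin 3) (Fin 3) ℝ), ?_, ?_, isoBlock_cov hn⟩
  · simpa only [Matrix.mul_one] using isoBlock_cov hn 1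
  · show ∑ _k : Fin n, (∑ a : Fin 3, ∑ b : Fin 3,
        (((Real.sqrt n)⁻¹ • (1 : Matrix (Fin 3) (Fin 3) ℝ)) a b) ^ 2) ^ 2 = 9 / n
    rw [isoBlock_frob hn]
    simp [Finset.sum_const, Finset.card_univ]
    field_simp
    ring

/-! ## Diffuse + unit + ADAPTED does not centre -/

/-- **Adapted unit rows need not centre.** For every `n ≥ 1` there is an adapted choice `w ↦ r(w)` of a
unit row with the minimal participation ratio `∑ₖ rₖ⁴ = 1/n` — namely `rₖ = ±1/√n` with the sign of `wₖ` —
whose output is `∑ₖ rₖ wₖ = ‖w‖₁/√n ≥ 0` for EVERY input: for i.i.d. centred `wₖ` with `E|w₁| = m > 0`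
its mean is `m√n → ∞`; diffuseness, isometry and adaptedness together give no central limit theorem.
[folklore] -/
theorem adapted_unit_rows_need_not_centre (n : ℕ) (hn : 0 < n) :
    ∃ r : (Fin n → ℝ) → (Fin n → ℝ),
      (∀ w, ∑ k, r w k ^ 2 = 1) ∧ (∀ w, ∑ k, r w k ^ 4 = 1 / n) ∧
      (∀ w, ∑ k, r w k * w k = (∑ k, |w k|) / Real.sqrt n) ∧ (∀ w, 0 ≤ ∑ k, r w k * w k) := by
  have hn' : (0 : ℝ) < n := by exact_mod_cast hn
  have s2 : ∀ x : ℝ, (if 0 ≤ x then (1 : ℝ) else -1) ^ 2 = 1 := fun x => by split_ifs <;> norm_num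
  have s4 : ∀ x : ℝ, (if 0 ≤ x then (1 : ℝ) else -1) ^ 4 = 1 := fun x => by split_ifs <;> norm_num
  have s1 : ∀ x : ℝ, (if 0 ≤ x then (1 : ℝ) else -1) * x = |x| := fun x => by
    split_ifs with h
    · rw [one_mul, abs_of_nonneg h]
    · rw [abs_of_neg (lt_of_not_ge h)]; ring
  have hs : Real.sqrt (n : ℝ) ^ 4 = (n : ℝ) ^ 2 := by
    rw [show (4 : ℕ) = 2 * 2 from rfl, pow_mul, Real.sq_sqrt hn'.le]
  have hout : ∀ w : Fin n → ℝ,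
      ∑ k, (if 0 ≤ w k then (1 : ℝ) else -1) / Real.sqrt n * w k = (∑ k, |w k|) / Real.sqrt n := by
    intro w
    simp only [div_mul_eq_mul_div, s1, Finset.sum_div]
  refine ⟨fun w k => (if 0 ≤ w k then (1 : ℝ) else -1) / Real.sqrt n, ?_, ?_, hout, fun w => ?_⟩
  · intro w
    simp [div_pow, s2, Real.sq_sqrt hn'.le, Finset.sum_const, Finset.card_univ]
    field_simp
  · intro w
    simp [div_pow, s4, hs, Finset.sum_const, Finset.card_univ]
    field_simp
  · rw [hout]
    exact div_nonneg (Finset.sum_nonneg fun k _ => abs_nonneg _) (Real.sqrt_nonneg _)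

/-! ## The reflection step: frozen components, transported anisotropy, the `2 + 1` split -/

/-- Normals orthogonal to a fixed direction `e` leave every velocity field along `e` untouched by
`reflectVel` (the fold step of the crux's transfer): the `e`-components are frozen, the self-block keeps
weight `≥ 1` on them, and H1 fails — the reflection-generated way to preserve an anisotropy is excluded by
H1 itself. [folklore] -/
theorem reflectVel_of_inner_eq_zero (n e : V3) (h : ⟪e, n⟫_ℝ = 0) (c₁ c₂ : ℝ) :
    reflectVel n (c₁ • e, c₂ • e) = (c₁ • e, c₂ • e) := by
  have : ⟪c₁ • e - c₂ • e, n⟫_ℝ = 0 := by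
    rw [← sub_smul, inner_smul_left, h]; simp
  simp [reflectVel, this]

/-- One reflection at normal projection `P = ωωᵀ` (`P² = P = Pᵀ`) turns the independent isotropic
covariances `θᵢ I` (self) and `θⱼ I` (partner) into `(I-P) θᵢ (I-P)ᵀ + P θⱼ Pᵀ = θᵢ I + (θⱼ - θᵢ) P`:
anisotropic whenever the temperatures differ.  Isotropy of the CLT covariance `∑ₖ M_ik Σₖ M_ikᵀ` is not a
consequence of the Lindeberg normalisation; it needs the realised normals to spread over the sphere
faster than the ancestors' temperatures spread. [folklore] -/
theorem one_reflection_covariance (P : Matrix (Fin 3) (Fin 3) ℝ) (hP : P * P = P) (hPt : Pᵀ = P)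
    (θi θj : ℝ) :
    (1 - P) * (θi • (1 : Matrix (Fin 3) (Fin 3) ℝ)) * (1 - P)ᵀ +
        P * (θj • (1 : Matrix (Fin 3) (Fin 3) ℝ)) * Pᵀ
      = θi • (1 : Matrix (Fin 3) (Fin 3) ℝ) + (θj - θi) • P := by
  rw [Matrix.transpose_sub, Matrix.transpose_one, hPt]
  simp only [Matrix.mul_smul, Matrix.smul_mul, sub_mul, mul_sub, one_mul, mul_one, hP,
    sub_self, sub_zero]
  rw [sub_smul]
  abel

/-- Parseval on `V3`: `∑ₐ nₐ² = ‖n‖²`. [folklore] -/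
theorem sum_sq_apply (n : V3) : ∑ a : Fin 3, (n a) ^ 2 = ‖n‖ ^ 2 := by
  rw [EuclideanSpace.norm_eq, Real.sq_sqrt (Finset.sum_nonneg fun _ _ => by positivity)]
  simp [Real.norm_eq_abs, sq_abs]

/-- `⟪e_a, n⟫ = nₐ` for the standard basis of `V3`. [folklore] -/
theorem inner_single_one_left (a : Fin 3) (n : V3) :
    ⟪(EuclideanSpace.single a (1 : ℝ) : V3), n⟫_ℝ = n a := by
  simp [EuclideanSpace.inner_single_left]

/-- After one reflection with (unnormalised) normal `n ≠ 0`, the Frobenius weight a fresh row puts on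
its PARTNER's velocity is exactly `1` (the block `ωωᵀ`). [folklore] -/
theorem partner_weight_after_reflection (n : V3) (hn : n ≠ 0) :
    ∑ a : Fin 3, ‖(reflectVel n ((0 : V3), (EuclideanSpace.single a (1 : ℝ) : V3))).1‖ ^ 2 = 1 := by
  have hn' : ‖n‖ ≠ 0 := norm_ne_zero_iff.2 hn
  have key : ∀ a : Fin 3, ‖(reflectVel n ((0 : V3), (EuclideanSpace.single a (1 : ℝ) : V3))).1‖ ^ 2
      = (n a) ^ 2 / ‖n‖ ^ 2 := by
    intro a
    simp only [reflectVel, zero_sub, inner_neg_left, inner_single_one_left, neg_div, neg_smul,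
      sub_neg_eq_add, zero_add, norm_smul, Real.norm_eq_abs, mul_pow, sq_abs]
    field_simp
  simp_rw [key, ← Finset.sum_div, sum_sq_apply]
  field_simp

/-- … and the weight it keeps on ITSELF is exactly `2` (the block `I - ωωᵀ`): a fresh row's budget `3`
splits `2 + 1`, so its ipr drops from `9` to `2² + 1² = 5`, whatever the normal. [folklore] -/
theorem self_weight_after_reflection (n : V3) (hn : n ≠ 0) :
    ∑ a : Fin 3, ‖(reflectVel n ((EuclideanSpace.single a (1 : ℝ) : V3), (0 : V3))).1‖ ^ 2 = 2 := by
  have hn' : ‖n‖ ≠ 0 := norm_ne_zero_iff.2 hn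
  have key : ∀ a : Fin 3, ‖(reflectVel n ((EuclideanSpace.single a (1 : ℝ) : V3), (0 : V3))).1‖ ^ 2
      = 1 - (n a) ^ 2 / ‖n‖ ^ 2 := by
    intro a
    simp only [reflectVel, sub_zero, inner_single_one_left]
    rw [norm_sub_sq_real, inner_smul_right, inner_single_one_left, norm_smul, Real.norm_eq_abs,
      mul_pow, sq_abs]
    simp
    field_simp
    ring
  simp_rw [key, Finset.sum_sub_distrib, ← Finset.sum_div, sum_sq_apply]
  simp
  field_simp
  norm_num

end AdaptedWeightCLTNegative

end Summit.AtomisticToContinuum.HydrodynamicLimit.Theorems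

end
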